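import Summits.Langlands.Langlands.Theorems.IrreducibilityBySelfDualityPairLBoundaryJSSpreadPairDatum

/-!
# Crux `PairLBoundaryJS` (stmt-Langlands-13622), line `Sketch` — stub
# `stub_spreadPairDatum_of_initialDatum` (W1): the spread pair datum from a PRESCRIBED initial datum

Summit `Langlands`, sub-problem `Langlands`, helper file under `Theorems/` supporting the crux
`PairLBoundaryJS` (Arthur–Clozel (1989), Ch. 3, (2.2)), line `Sketch`, registered stub
`stub_spreadPairDatum_of_initialDatum`.

This is lead c2's `Summit.Langlands.Langlands.Theorems.SpreadPairDatum.exists_spreadPairDatum`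
(the pair form of `Literature.NumberTheory.Automorphic.exists_spreadDatum`,
`PairLFunctionPolesEqConjArch`, Part 3) re-run with the initial datum `(𝔫₁, f₁)` (`𝔫₁ ≠ 0`,
`f₁ ∈ Π` fixed by `K(𝔫₁)`) and the archimedean bump `β` (continuous, compactly supported, smooth
along `u · exp X`) as HYPOTHESES instead of `exists_initialDatum`, and with the witnesses exported:
the places `T = T₀ ∪ supp(𝔫₁ 𝔫')`, the depth `m`, the level `𝔫 = 𝔫₁ 𝔫' ∏_{v ∈ T} 𝔭_v^{k_v}`
(`𝔫' ∣ 𝔫`, `𝔫₁ ∣ 𝔫`, primes in `T`), the spread parameters `(c, e, ϖ, L)` with `SpreadHyp` on `L`,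
`L.Nodup`, `L ↔ T`, `exp(-e_v) ≤ idealRadius_v(𝔫₁ 𝔫')`, the spread vector `f = E_L f₁`
(`spreadIter`) fixed by `K(𝔫)`; then, for every admissible `β`, the test function
`η = β ⊗ 𝟙_{K_f(𝔫)}` with its two left invariances, a constant `a > 0` and the smoothing formula
`S_η f = a • E_L (S_{η₁} f₁)` (`η₁ = β ⊗ 𝟙_{K_f(𝔫₁)}`), and at every `v ∈ T` the spread block
(torus parameters, `IsSpreadWhittakerAt`, `ψ_v`-non-triviality, `1 ≤ M`, `ord_v 𝔫' ≤ M`,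
monotonicity, gaps, depth). The non-vanishing conclusion of the source is dropped (users transfer
it from `f₁` by `toContRep_spreadIter` / `whittakerFunctional_spreadIter`).

## References

* H. Jacquet, J. A. Shalika, *On Euler products and the classification of automorphic
  representations I*, Amer. J. Math. 103 (1981), §4–§5 [JacquetShalikaAJM1981].
* J. Arthur, L. Clozel, *Simple algebras, base change, and the advanced theory of the trace
  formula* (1989), Ch. 3, (2.2)–(2.3) [ArthurClozelAMS120].
* H. Jacquet, I. I. Piatetski-Shapiro, J. Shalika, *Conducteur des représentations du groupe
  linéaire*, Math. Ann. 256 (1981), §5.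
-/

noncomputable section

-- `Summit.Langlands.Langlands.…` (summit = sub-problem name, D-0017 layout) trips `dupNamespace`
set_option linter.dupNamespace false

open scoped MatrixGroups Topology Pointwise ENNReal NNReal ComplexConjugate InnerProductSpace ContDiff
-- the place subtypes indexing `mixedSpace K` are `Fintype` classically (`NormedCommRing (mixedSpace K)`)
open scoped Classical Matrix.Norms.Operator
open NumberField IsDedekindDomain MeasureTheory Measure Matrix Set Filter WithZero
open NumberField.mixedEmbedding
open Literature.NumberTheory.Automorphic AdelicGroupData
open Literature.NumberTheory.GaloisRepresentations (ideleGroup HeckeCharacter)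
open ValuativeRel

-- the automorphic quotient carries the tree's Borel σ-algebra, not Mathlib's quotient σ-algebra
attribute [-instance] Quotient.instMeasurableSpace QuotientGroup.measurableSpace

-- the house local instances, exactly as in `RankinSelbergUnfoldingIdentity`
attribute [local instance] adelicBorel borelSpace_adelic locallyCompactSpace_adelic secondCountableTopology_gl_adelic
  glAdeleBorel borelSpace_glAdele borelSpace_ideleGroup secondCountableTopology_ideleGroup

-- Mathlib idiom: the commutator Lie ring on matrices, to mention `(archGroupGL n K).lie`
attribute [local instance 100] LieRing.ofAssociativeRing

namespace Summit.Langlands.Langlands.Theorems.SpreadPairDatumOfInitialDatum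

open Literature.NumberTheory.Automorphic.WhittakerSupport

-- the local instances of the source (`PairLFunctionPolesEqConjArch`, Part 3, section `Final`)
attribute [local instance] glInfBorel borelSpace_glInf locallyCompactSpace_glInf secondCountableTopology_glInf

attribute [local instance] finiteDimensional_matrix_mixedSpace

set_option maxHeartbeats 1600000 in
set_option synthInstance.maxHeartbeats 200000 in
set_option backward.isDefEq.respectTransparency false in
/-- **The spread pair datum from a prescribed initial datum.** For a cuspidal automorphic
representation `Π` of `GL_{n+1}(𝔸_K)`, a finite set `T₀` of finite places, a partner level `𝔫' ≠ 0`
and an initial datum `(𝔫₁ ≠ 0, f₁ ∈ Π)` with `f₁` fixed by `K(𝔫₁)`: with `T = T₀ ∪ supp(𝔫₁ 𝔫')`,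
conductor exponents `c_v` of `ψ_v`, level exponents `e_v = max(max(c_v, 0), ord_v(𝔫₁ 𝔫'))`,
uniformizers `ϖ_v`, `L` an enumeration of `T`, the level `𝔫 = 𝔫₁ 𝔫' ∏_{v ∈ T} 𝔭_v^{k_v}`
(`𝔫' ∣ 𝔫`, `𝔫₁ ∣ 𝔫`, prime factors in `T`) and the depth
`m = 1 + Σ_{v ∈ T} (M_v + n (M_v - c_v))⁺`, the spread vector `f = E_L f₁` (`spreadIter`) is fixed by
`K(𝔫)`; and for every archimedean bump `β` (continuous, compactly supported, smooth along
`u · exp X`) the test function `η = β ⊗ 𝟙_{K_f(𝔫)}` is left `(1, K_f(𝔫))`- and left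
`K(𝔫)`-invariant, `S_η f = a • E_L (S_{η₁} f₁)` with `η₁ = β ⊗ 𝟙_{K_f(𝔫₁)}` and
`a = c_{K_f(𝔫)} / c_{K_f(𝔫₁)} > 0` (ratio of archimedean shadow constants), and at every `v ∈ T`
the Whittaker coefficient of `S_η f` is spread bi-equivariant (`IsSpreadWhittakerAt`) for the torus
parameters `spreadTorus`, the level exponent `M_v = spreadM c_v e_v ≥ max(1, ord_v 𝔫')` and the
conductor exponent `c_v`, with the monotonicity, gap and depth inequalities of the support theorem.
Lead c2's `SpreadPairDatum.exists_spreadPairDatum` re-run from the prescribed initial datum (its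
proof verbatim from `𝔫₂ = 𝔫₁ 𝔫'` on), the non-vanishing conclusion dropped (Jacquet–Shalika (1981)
§4–§5; JPSS (1981) §5; Arthur–Clozel (1989) Ch. 3 (2.2)–(2.3)).
[cite: JacquetShalikaAJM1981, §4–§5] [cite: ArthurClozelAMS120, Ch. 3 §2 (2.2)–(2.3)] -/
theorem stub_spreadPairDatum_of_initialDatum :
    ∀ {n : ℕ} {K : Type} [Field K] [NumberField K]
      {μ : Measure (AdelicGroupData.gl (n + 1) K).automorphicQuotient} [(AdelicGroupData.gl (n + 1) K).IsAutomorphicMeasure μ]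
      [MeasurableSpace (AdeleRing (𝓞 K) K)] [BorelSpace (AdeleRing (𝓞 K) K)]
      (P : CuspidalAutomorphicRepGL (n + 1) K μ) (T₀ : Finset (HeightOneSpectrum (𝓞 K)))
      {𝔫' 𝔫₁ : Ideal (𝓞 K)} (_ : 𝔫' ≠ 0) (_ : 𝔫₁ ≠ 0) (f₁ : P.1.toSubmodule)
      (_ : ∀ g ∈ principalCongruenceLevel (n + 1) K 𝔫₁, P.1.toContRep g f₁ = f₁),
    ∃ (T : Finset (HeightOneSpectrum (𝓞 K))) (_ : T₀ ⊆ T) (_ : ∀ v ∈ T, v ∈ T₀ ∨ v.asIdeal ∣ 𝔫₁ * 𝔫')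
      (m : ℕ) (_ : 1 ≤ m) (𝔫 : Ideal (𝓞 K)) (_ : 𝔫 ≠ 0) (_ : 𝔫' ∣ 𝔫) (_ : 𝔫₁ ∣ 𝔫)
      (_ : ∀ v : HeightOneSpectrum (𝓞 K), v.asIdeal ∣ 𝔫 → v ∈ T)
      (c e : HeightOneSpectrum (𝓞 K) → ℤ) (ϖ : ∀ v : HeightOneSpectrum (𝓞 K), (v.adicCompletion K)ˣ)
      (L : List (HeightOneSpectrum (𝓞 K))) (_ : ∀ v ∈ L, SpreadHyp (K := K) c e ϖ v) (_ : L.Nodup)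
      (_ : ∀ v, v ∈ L ↔ v ∈ T) (_ : ∀ v ∈ L, exp (-e v) ≤ idealRadius K v (𝔫₁ * 𝔫'))
      (f : P.1.toSubmodule) (_ : f = spreadIter P.1 c e ϖ L f₁)
      (_ : ∀ g ∈ principalCongruenceLevel (n + 1) K 𝔫, P.1.toContRep g f = f),
    ∀ {β : GL (Fin (n + 1)) (mixedSpace K) → ℝ}, Continuous β → HasCompactSupport β →
      (∀ u : GL (Fin (n + 1)) (mixedSpace K), ContDiff ℝ ∞ fun X : (archGroupGL (n + 1) K).lie.toSubmodule => β (u * expGL (X : Matrix (Fin (n + 1)) (Fin (n + 1)) (mixedSpace K)))) →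
    ∃ (η : (AdelicGroupData.gl (n + 1) K).Adelic → ℝ) (a : ℝ), η = archLevelWeight (finitePrincipalCongruenceLevel (n + 1) K 𝔫) β ∧
      IsTestFunctionGL (n + 1) K η ∧ 0 < a ∧
      (∀ u ∈ finitePrincipalCongruenceLevel (n + 1) K 𝔫, ∀ g : GL (Fin (n + 1)) (AdeleRing (𝓞 K) K), η (GLn.ofFinite (n + 1) K u * g) = η g) ∧
      (∀ k : (AdelicGroupData.gl (n + 1) K).Adelic, k ∈ principalCongruenceLevel (n + 1) K 𝔫 → ∀ g : (AdelicGroupData.gl (n + 1) K).Adelic, η (k * g) = η g) ∧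
      smoothedVector P.1 η f =
        (a : ℂ) • spreadIter P.1 c e ϖ L (smoothedVector P.1 (archLevelWeight (finitePrincipalCongruenceLevel (n + 1) K 𝔫₁) β) f₁) ∧
      ∀ (ν₀ : Measure ↥(adelicUnipotent (n + 1) K)) (_ : IsHaarMeasure ν₀), ∀ v ∈ T,
        ∃ (tv : Fin (n + 1) → (v.adicCompletion K)ˣ) (M c₀ : ℤ),
          IsSpreadWhittakerAt v (adeleAddChar K) tv M (whittakerCoeff ν₀ (unipotentTateDomain (n + 1) K) (adeleAddChar K) (invQuot (AdelicGroupData.gl (n + 1) K) (smoothedForm η ((f : P.1.toSubmodule) : (AdelicGroupData.gl (n + 1) K).L2 μ)))) ∧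
          (∃ y : v.adicCompletion K, Valued.v y ≤ exp (1 - c₀) ∧ (adeleAddChar K).adicComponent v y ≠ 1) ∧ 1 ≤ M ∧
          ((Associates.mk v.asIdeal).count (Associates.mk 𝔫').factors : ℤ) ≤ M ∧
          (∀ i j : Fin (n + 1), i ≤ j → Valued.v (tv j : v.adicCompletion K) ≤ Valued.v (tv i : v.adicCompletion K)) ∧
          (∀ i j : Fin (n + 1), (i : ℕ) + 1 = j → exp (M - c₀) * Valued.v (tv j : v.adicCompletion K) ≤ Valued.v (tv i : v.adicCompletion K)) ∧
          exp (-(m : ℤ)) * Valued.v (tv 0 : v.adicCompletion K) ≤ exp (-M) * Valued.v (tv (Fin.last n) : v.adicCompletion K) := by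
  intro n K _ _ μ _ _ _ P T₀ 𝔫' 𝔫₁ h𝔫' h𝔫₁ f₁ hf₁fix
  classical
  -- the enlarged initial level `𝔫₂ = 𝔫₁ 𝔫'`
  set 𝔫₂ : Ideal (𝓞 K) := 𝔫₁ * 𝔫' with h𝔫₂def
  have h𝔫₂ : 𝔫₂ ≠ 0 := mul_ne_zero h𝔫₁ h𝔫'
  have hf₁fix₂ : ∀ g ∈ principalCongruenceLevel (n + 1) K 𝔫₂, P.1.toContRep g f₁ = f₁ := fun g hg =>
    hf₁fix g (principalCongruenceLevel_mono (n + 1) K h𝔫₂ Ideal.mul_le_right hg)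
  -- per-place data
  have hcond : ∀ v : HeightOneSpectrum (𝓞 K), ∃ d : ℤ, ((adeleAddChar K).adicComponent v).HasConductorExp d := fun v =>
    ((isGlobalAddChar_adeleAddChar (K := K)).isContinuousNontrivial_adicComponent
      (adicComponent_adeleAddChar_ne_one v)).exists_hasConductorExp
  choose c hc using hcond
  obtain ⟨ϖ, hϖ⟩ := exists_uniformizers (K := K)
  set cnt : HeightOneSpectrum (𝓞 K) → ℕ := fun v => (Associates.mk v.asIdeal).count (Associates.mk 𝔫₂).factors with hcnt
  set e : HeightOneSpectrum (𝓞 K) → ℤ := fun v => max (max (c v) 0) (cnt v : ℤ) with he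
  have hH : ∀ v, SpreadHyp (K := K) c e ϖ v := fun v =>
    { cond := fun y hy => (hc v).1 y ((mem_primePowBall_adicCompletion_iff (v := v)).2 hy)
      e_nonneg := le_trans (le_max_right _ _) (le_max_left _ _)
      c_le_e := le_trans (le_max_left _ _) (le_max_left _ _)
      unif := hϖ v }
  have hrad : ∀ v, exp (-e v) ≤ idealRadius K v 𝔫₂ := fun v => by
    rw [idealRadius_eq_exp_neg_natCast v h𝔫₂, exp_le_exp, neg_le_neg_iff]
    exact le_max_right _ _
  have hcnt' : ∀ v, ((Associates.mk v.asIdeal).count (Associates.mk 𝔫').factors : ℤ) ≤ spreadM (c v) (e v) := by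
    intro v
    have h1 : (Associates.mk v.asIdeal).count (Associates.mk 𝔫').factors ≤ cnt v :=
      Associates.count_le_count_of_le (Associates.mk_ne_zero.2 h𝔫₂) v.associates_irreducible
        (Associates.mk_le_mk_of_dvd (dvd_mul_left 𝔫' 𝔫₁))
    have h2 : (cnt v : ℤ) ≤ e v := le_max_right _ _
    calc ((Associates.mk v.asIdeal).count (Associates.mk 𝔫').factors : ℤ) ≤ (cnt v : ℤ) := by exact_mod_cast h1
      _ ≤ spreadM (c v) (e v) := h2.trans (le_spreadM (c v) (e v))
  -- the places, the vector, the level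
  set T : Finset (HeightOneSpectrum (𝓞 K)) := T₀ ∪ (Ideal.finite_factors h𝔫₂).toFinset with hT
  have hTmem : ∀ v ∈ T, v ∈ T₀ ∨ v.asIdeal ∣ 𝔫₂ := by
    intro v hv
    rcases Finset.mem_union.1 hv with h | h
    · exact Or.inl h
    · exact Or.inr ((Ideal.finite_factors h𝔫₂).mem_toFinset.1 h)
  set L : List (HeightOneSpectrum (𝓞 K)) := T.toList with hL
  have hnd : L.Nodup := Finset.nodup_toList T
  have hLT : ∀ v, v ∈ L ↔ v ∈ T := fun v => Finset.mem_toList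
  set k : HeightOneSpectrum (𝓞 K) → ℕ := fun v => spreadK (n + 1) (c v) (e v) with hk
  set f : P.1.toSubmodule := spreadIter P.1 c e ϖ L f₁ with hf
  set 𝔫 : Ideal (𝓞 K) := spreadLevelIdeal 𝔫₂ k L with h𝔫def
  have h𝔫 : 𝔫 ≠ 0 := spreadLevelIdeal_ne_zero h𝔫₂ k L
  have h𝔫'dvd : 𝔫' ∣ 𝔫 := Ideal.dvd_iff_le.2 ((spreadLevelIdeal_le 𝔫₂ k L).trans Ideal.mul_le_left)
  have h𝔫₁dvd : 𝔫₁ ∣ 𝔫 := Ideal.dvd_iff_le.2 ((spreadLevelIdeal_le 𝔫₂ k L).trans Ideal.mul_le_right)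
  have hprimes : ∀ v : HeightOneSpectrum (𝓞 K), v.asIdeal ∣ 𝔫 → v ∈ T := by
    intro v hv
    rcases mem_or_dvd_of_dvd_spreadLevelIdeal k hv with h | h
    · exact Finset.mem_union_right _ ((Ideal.finite_factors h𝔫₂).mem_toFinset.2 h)
    · exact (hLT v).1 h
  have hffix : ∀ g ∈ principalCongruenceLevel (n + 1) K 𝔫, P.1.toContRep g f = f :=
    toContRep_spreadIter_of_mem_principalCongruenceLevel h𝔫₂ (fun v _ => hH v) hnd hf₁fix₂
  have hffixK : ∀ u ∈ finitePrincipalCongruenceLevel (n + 1) K 𝔫, P.1.toContRep (GLn.ofFinite (n + 1) K u) f = f :=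
    fun u hu => hffix _ (mem_finitePrincipalCongruenceLevel_iff.1 hu)
  have hKo := isOpen_finitePrincipalCongruenceLevel (n + 1) K h𝔫
  have hKc := isCompact_finitePrincipalCongruenceLevel (n + 1) K h𝔫
  -- the depth
  set m : ℕ := 1 + ∑ v ∈ T, (spreadM (c v) (e v) + n * (spreadM (c v) (e v) - c v)).toNat with hm
  have hmv : ∀ v ∈ T, spreadM (c v) (e v) + n * (spreadM (c v) (e v) - c v) ≤ m := by
    intro v hv
    have h1 : (spreadM (c v) (e v) + n * (spreadM (c v) (e v) - c v)).toNat ≤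
        ∑ w ∈ T, (spreadM (c w) (e w) + n * (spreadM (c w) (e w) - c w)).toNat :=
      Finset.single_le_sum (f := fun w => (spreadM (c w) (e w) + n * (spreadM (c w) (e w) - c w)).toNat)
        (fun _ _ => Nat.zero_le _) hv
    have h2 := Int.self_le_toNat (spreadM (c v) (e v) + n * (spreadM (c v) (e v) - c v))
    have h3 : ((∑ w ∈ T, (spreadM (c w) (e w) + n * (spreadM (c w) (e w) - c w)).toNat : ℕ) : ℤ) ≤ (m : ℤ) := by
      rw [hm]; exact_mod_cast Nat.le_add_left _ _
    calc spreadM (c v) (e v) + n * (spreadM (c v) (e v) - c v)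
        ≤ ((spreadM (c v) (e v) + n * (spreadM (c v) (e v) - c v)).toNat : ℤ) := h2
      _ ≤ ((∑ w ∈ T, (spreadM (c w) (e w) + n * (spreadM (c w) (e w) - c w)).toNat : ℕ) : ℤ) := by exact_mod_cast h1
      _ ≤ m := h3
  refine ⟨T, Finset.subset_union_left, hTmem, m, by omega, 𝔫, h𝔫, h𝔫'dvd, h𝔫₁dvd, hprimes, c, e, ϖ, L,
    fun v _ => hH v, hnd, hLT, fun v _ => hrad v, f, hf, hffix, ?_⟩
  -- the archimedean bump
  intro β hβc hβs hβsm
  set η : GL (Fin (n + 1)) (AdeleRing (𝓞 K) K) → ℝ := archLevelWeight (finitePrincipalCongruenceLevel (n + 1) K 𝔫) β with hηdef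
  have hη : IsTestFunctionGL (n + 1) K η := isTestFunctionGL_archLevelWeight hβc hβs hβsm hKo hKc
  have hηleft : ∀ u ∈ finitePrincipalCongruenceLevel (n + 1) K 𝔫, ∀ g : GL (Fin (n + 1)) (AdeleRing (𝓞 K) K),
      η (GLn.ofFinite (n + 1) K u * g) = η g := fun u hu g => archLevelWeight_ofFinite_mul β hu g
  have hηleft' : ∀ k' : (AdelicGroupData.gl (n + 1) K).Adelic, k' ∈ principalCongruenceLevel (n + 1) K 𝔫 →
      ∀ g : (AdelicGroupData.gl (n + 1) K).Adelic, η (k' * g) = η g := by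
    intro k' hk' g
    have h1 : GLn.ofFinite (n + 1) K (GLn.sndHom (n + 1) K k') = k' :=
      GLn.ofFinite_sndHom_of_mem (principalCongruenceLevel_le (n + 1) K 𝔫 hk')
    have h2 : GLn.sndHom (n + 1) K k' ∈ finitePrincipalCongruenceLevel (n + 1) K 𝔫 := by
      rw [mem_finitePrincipalCongruenceLevel_iff, h1]; exact hk'
    have h3 := hηleft _ h2 g
    rwa [h1] at h3
  -- the initial smoothed vector `x₁` (level `𝔫₁`) and the formula `S_η f = a • E_L x₁`
  set η₁ : GL (Fin (n + 1)) (AdeleRing (𝓞 K) K) → ℝ := archLevelWeight (finitePrincipalCongruenceLevel (n + 1) K 𝔫₁) β with hη₁def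
  have hK₁o := isOpen_finitePrincipalCongruenceLevel (n + 1) K h𝔫₁
  have hK₁c := isCompact_finitePrincipalCongruenceLevel (n + 1) K h𝔫₁
  set x₁ : P.1.toSubmodule := smoothedVector P.1 η₁ f₁ with hx₁
  have hf₁fixK : ∀ u ∈ finitePrincipalCongruenceLevel (n + 1) K 𝔫₁, P.1.toContRep (GLn.ofFinite (n + 1) K u) f₁ = f₁ :=
    fun u hu => hf₁fix _ (mem_finitePrincipalCongruenceLevel_iff.1 hu)
  set c𝔫 : ℝ := (archShadowConst (n := n + 1) (K := K) hKo
    (by rw [((finitePrincipalCongruenceLevel (n + 1) K 𝔫).isClosed_of_isOpen hKo).closure_eq]; exact hKc) : ℝ) with hc𝔫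
  set c₁ : ℝ := (archShadowConst (n := n + 1) (K := K) hK₁o
    (by rw [((finitePrincipalCongruenceLevel (n + 1) K 𝔫₁).isClosed_of_isOpen hK₁o).closure_eq]; exact hK₁c) : ℝ) with hc₁
  have hc₁pos : 0 < c₁ := archShadowConst_pos _ hK₁o hK₁c
  have hc𝔫pos : 0 < c𝔫 := archShadowConst_pos _ hKo hKc
  have hI : ∫ h, (β h : ℂ) • P.1.toContRep (GLn.ofInfinite (n + 1) K h) f₁ ∂(archHaar (n + 1) K) = ((c₁⁻¹ : ℝ) : ℂ) • x₁ := by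
    rw [hx₁, hη₁def, smoothedVector_archLevelWeight_eq_smul_archIntegral hβc hβs hK₁o hK₁c hf₁fixK, smul_smul]
    push_cast
    rw [inv_mul_cancel₀ (by exact_mod_cast hc₁pos.ne'), one_smul]
  have hu : smoothedVector P.1 η f = ((c𝔫 * c₁⁻¹ : ℝ) : ℂ) • spreadIter P.1 c e ϖ L x₁ := by
    rw [hηdef, smoothedVector_archLevelWeight_eq_smul_archIntegral hβc hβs hKo hKc hffixK, hf,
      ← spreadIter_archIntegral (fun v _ => hH v) hβc hβs, hI, spreadIter_smul, smul_smul]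
    push_cast
    rfl
  refine ⟨η, c𝔫 * c₁⁻¹, rfl, hη, mul_pos hc𝔫pos (inv_pos.2 hc₁pos), hηleft, hηleft', hu, fun ν₀ hν₀ v hv => ?_⟩
  -- the data at `v ∈ T`
  haveI := hν₀
  have hv' : v ∈ L := (hLT v).2 hv
  have hisoF := isotypic_spreadIter (W := P.1) (fun v _ => hH v) hnd f₁ v hv'
  have hisoI := isotypic_archIntegral hisoF hβc hβs
  have hiso : ∀ h ∈ spreadLevelGroup (spreadTorus (n + 1) (ϖ v) (c v) (e v)) (spreadM (c v) (e v)),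
      P.1.toContRep (GLn.ofLocal (n + 1) K v h) (smoothedVector P.1 η f) = spreadChar v h • smoothedVector P.1 η f := by
    intro h hh
    rw [hηdef, smoothedVector_archLevelWeight_eq_smul_archIntegral hβc hβs hKo hKc hffixK, map_smul, hf, hisoI h hh,
      smul_comm]
  obtain ⟨x, hx, hx1⟩ := (hc v).2
  refine ⟨spreadTorus (n + 1) (ϖ v) (c v) (e v), spreadM (c v) (e v), c v,
    isSpreadWhittakerAt_of_isotypic ν₀ (le_trans zero_le_one (one_le_spreadM (hH v).e_nonneg)) (hH v).hψ hη f hiso,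
    ⟨x, ?_, hx1⟩, one_le_spreadM (hH v).e_nonneg, hcnt' v,
    valuation_spreadTorus_antitone (hH v).e_nonneg (hH v).unif,
    valuation_spreadTorus_gap (hH v).unif, valuation_spreadTorus_depth (hH v).unif (hmv v hv)⟩
  have h1 := (mem_primePowBall_adicCompletion_iff (v := v)).1 hx
  rwa [show (-(c v - 1) : ℤ) = 1 - c v by ring] at h1

end Summit.Langlands.Langlands.Theorems.SpreadPairDatumOfInitialDatum
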